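import Literature.NumberTheory.GaloisCohomology.PoitouTateSumTotallyComplex
import Literature.NumberTheory.EllipticCurves.HeegnerPointsImaginaryQuadraticProofs
import HarnessLib

set_option linter.dupNamespace false
set_option autoImplicit false

/-!
# `stub_textbookDualityImQuad`: the Poitou–Tate sum formula for imaginary quadratic fields

The registered textbook stub shared by the cn100 lines of record on the items
`RankPosOfTwoSelmerCorankOne` / `AnalyticRankOneOfRankOneFiniteShaTwo` (S2, `CongruentShaFreeCut`)
and their S2b twins (`MordellShaFreeCut`):

  `∀ (K : Type) [Field K] [NumberField K], IsImaginaryQuadratic K → poitouTate_sum_localTatePairing_eq_zero K`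

— the reciprocity law `∑_v inv_v = 0` on `H²(Γ_K, μ_n)` (Tate, Cassels–Fröhlich VII §9.6/§11;
Milne ADT I 4.10) for the Heegner fields `K`.  It is the specialisation of the tree's theorem for
totally complex number fields, `poitouTate_sum_localTatePairing_eq_zero_of_isTotallyComplex`
(`Literature/NumberTheory/GaloisCohomology/PoitouTateSumTotallyComplex.lean`, the (F1) campaign of
`pub/bsd-cn100`), via `IsImaginaryQuadratic.isTotallyComplex`.  Sorry-free, standard axioms.
-/

namespace Summit.BirchSwinnertonDyer.BirchSwinnertonDyer.Theorems.CongruentShaFreeCutTextbookDualityImQuad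

open NumberField Literature.NumberTheory.EllipticCurves Literature.NumberTheory.GaloisCohomology

/-- **The Poitou–Tate sum formula for imaginary quadratic fields** (registered stub
`stub_textbookDualityImQuad`, signature verbatim): for an imaginary quadratic field `K` and every
`n ≥ 1`, the canonical local invariant maps on `H²(Γ_{K_v}, μ_n)` form a perfect family along which
the invariants of every global class sum to zero.  Proof: `K` is totally complex
(`IsImaginaryQuadratic.isTotallyComplex`) and the law holds for totally complex number fields
(`poitouTate_sum_localTatePairing_eq_zero_of_isTotallyComplex`, Tate's theorem).
[cite: CasselsFrohlichANT1967, Ch. VII §11] -/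
theorem stub_textbookDualityImQuad :
    ∀ (K : Type) [Field K] [NumberField K], IsImaginaryQuadratic K →
      poitouTate_sum_localTatePairing_eq_zero K := by
  intro K _ _ hK
  haveI : IsTotallyComplex K := hK.isTotallyComplex
  exact poitouTate_sum_localTatePairing_eq_zero_of_isTotallyComplex K

end Summit.BirchSwinnertonDyer.BirchSwinnertonDyer.Theorems.CongruentShaFreeCutTextbookDualityImQuad
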